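import Summits.AtomisticToContinuum.BoseEinsteinCondensation.Theorems.BECThomsonPrincipleGDTransferSeededDefs
import Summits.AtomisticToContinuum.BoseEinsteinCondensation.Theorems.BECThomsonPrincipleGDTransferChordVariation
import Summits.AtomisticToContinuum.BoseEinsteinCondensation.Theorems.BECThomsonPrincipleGDTransferLnssAlgebra
import Summits.AtomisticToContinuum.BoseEinsteinCondensation.Theorems.BECConjugateDominationNearMinimiserStabilityHelpers

/-!
# Route `BECThomsonPrinciple`, crux `GDTransfer` (stmt-AtomisticToContinuum-9482), line `seeded-continuity`:
# second Defs file — the PLAIN witness pair and the reshaping of `stub_projectedDichotomy` into five stubs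

`Defs` file (D-0016) continuing `BECThomsonPrincipleGDTransferSeededDefs.lean` (p137609).  The registered stub
`stub_projectedDichotomy : GaussianDominationCan → ∀ v adm finite-continuous, BandEmptiness v` (the only consumer of
Gaussian domination in the line) is reshaped (lead, skeleton v3) into five registered stubs composed here sorry-free
(`projectedDichotomy_of`), mirroring the landed chain of the dead line `dyson-dressed-witness`
(`stub_chordVariation` ⟶ witness family ⟶ `stub_windowLaw` ⟶ `stub_modeCounting`) with ONE change of object: the
Lewin–Nam–Serfaty–Solovej pair `Λ_k†Ψ, Λ_kΨ` (whose interaction second variation is state-dependent — the removal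
anomaly `[V, n̂₀^{-1/2}]`, the cause of death of all three KLS lines) is replaced by the PLAIN one-body pair

  `B_kΨ = a_k†a₀Ψ = Σ_i e_k(x_i)·P_iΨ` (`plainUp`),   `B_k†Ψ = a₀†a_kΨ = Σ_i P_i^{(k)}Ψ` (`plainDown`),

scaled by `N^{-1/2}`.  No `n̂₀^{-1/2}` occurs, so the KLS double commutator of `B_k` is the TEXTBOOK one
(`[T, B_k] = |k|²B_k` exactly; the interaction part is a genuine two-body operator bounded by `C ρ‖v‖₁ N` through
Jensen for cell averages and Cauchy–Schwarz against `⟨Ψ, v_12Ψ⟩ = 2E(Ψ)/N²`).  The price is the weight `√(n̂₀/N)`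
in the overlap with the crux's LNSS source: `⟨B_kΨ, Λ_k†Ψ⟩ = E[(n̂_k+1)n̂₀^{1/2}]`, `⟨Λ_kΨ, B_k†Ψ⟩ = E[n̂_k(n̂₀+1)^{1/2}]`
— affordable here, because the line needs only the `n̂₀`-WEIGHTED momentum law: the controlled per-mode quantity is the
weighted occupation `N⁻¹‖a₀†a_kΨ‖² = N⁻¹E[n̂_k(n̂₀+1)]` (`weightedOcc`), whose sum over `k ≠ 0` is
`E[(N − n̂₀)(n̂₀+1)]/N ≥ θβN·P(θN ≤ n̂₀ < (1−β)N)` (Markov on the band).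

Objects: `plainUp`, `plainDown`, `weightedOcc`; interfaces `PlainPairAlgebra` ((L1)-type regularity, a-priori budgets,
zero defect (W3) against the LNSS source, (W4) for the weighted occupation), `PlainPairCost` (the KLS second variation
(W2) at near-minimisers — the analytic heart), `WeightedWitnessFamilyFor v` (= `DressedWitnessFamilyFor v` with (W4) on
`weightedOcc`), `WeightedWindowBoundFor v`; registered signatures `Sig.stub_plainPairAlgebra`, `Sig.stub_plainInteraction`,
`Sig.stub_plainPairCost`, `Sig.stub_weightedWindowLaw`, `Sig.stub_bandFromWindow`; glue `weightedFamily_of_plain` (clone of `dwf_of_bare`),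
`lintegral_ne_top_of_isFiniteContinuous`, `projectedDichotomy_of` (the three/four statements + the landed
`stub_chordVariation`, `stub_lnssAlgebra` ⇒ `Sig.stub_projectedDichotomy`).  Nothing open is asserted.

References: KennedyLiebShastry1988 (JSP 53, 1019), KLS1988PRL (the `T = 0` infrared-bound ⇒ order mechanism with a
bounded double commutator); PitaevskiiStringari1991 (uncertainty-relation form); arXiv:1211.2778 (LNSS source);
LSSY2005 Thm 2.2, App. C (C.10) (`4πa ≤ ‖v‖₁/2`).
-/

noncomputable section

open MeasureTheory Filter
open scoped ENNReal NNReal ComplexConjugate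

namespace Summit.AtomisticToContinuum.BoseEinsteinCondensation.Cruxes.GDTransfer.Seeded

open Literature.MathematicalPhysics.QuantumManyBody.BoseGas
open Summit.AtomisticToContinuum.BoseEinsteinCondensation.Theses.BECThomsonPrinciple
open Summit.AtomisticToContinuum.BoseEinsteinCondensation.Theorems.GaussianDominationCan.Negative
  (cellAvg modeProj InWindow)
open Summit.AtomisticToContinuum.BoseEinsteinCondensation.Cruxes.GDTransfer.DysonDressedWitness
  (PeriodicBECFor gdTransfer_iff srcPair fourierAvg IsDirection mass eform windowSum windowSum_zero TwoSidedDualNorm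
    LNSSAlgebra stub_chordVariation stub_lnssAlgebra)

variable {m : ℕ}

/-! ## §0 The plain pair and the weighted occupation -/

/-- `ζ₊ = N^{-1/2} B_n g`, `B_n := a_n†a₀ = Σ_i e_n(x_i)·P_i` — move one particle from the constant mode to the plane
wave `e_n` (first quantisation: `|φ_n⟩⟨φ₀|_i = e_n(x_i)·P_i`), with the KLS scaling `N^{-1/2}` built in. -/
def plainUp (m : ℕ) (L : ℝ) (n : Fin 3 → ℤ) (g : Config (m + 1) → ℂ) : Config (m + 1) → ℂ :=
  fun X => ((Real.sqrt ((m + 1 : ℕ) : ℝ))⁻¹ : ℂ) * ∑ i : Fin (m + 1), cellWave L n (X i) * cellAvg (m + 1) L i g X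

/-- `ζ₋ = N^{-1/2} B_n† g`, `B_n† := a₀†a_n = Σ_i P_i^{(n)}` — the adjoint move (`|φ₀⟩⟨φ_n|_i = fourierAvg n i`),
scaled by `N^{-1/2}`. -/
def plainDown (m : ℕ) (L : ℝ) (n : Fin 3 → ℤ) (g : Config (m + 1) → ℂ) : Config (m + 1) → ℂ :=
  fun X => ((Real.sqrt ((m + 1 : ℕ) : ℝ))⁻¹ : ℂ) * ∑ i : Fin (m + 1), fourierAvg m L n i g X

/-- The WEIGHTED OCCUPATION `N⁻¹‖a₀†a_n ψ‖² = N⁻¹⟨ψ, n̂_n(n̂₀+1)ψ⟩` of the mode `n` (the momentum occupation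
weighted by the condensate fraction; `≤ n_n(ψ)` by Cauchy–Schwarz, `Σ_{n≠0} = ⟨ψ,(N−n̂₀)(n̂₀+1)ψ⟩/N`). -/
def weightedOcc (m : ℕ) (L : ℝ) (n : Fin 3 → ℤ) (ψ : Config (m + 1) → ℂ) : ℝ≥0∞ :=
  mass L (plainDown m L n ψ)

/-- The KINETIC sesquilinear form `t(f, g) = ∫_{cell^N} Σ_{j,a} conj(∂_{j,a}f) ∂_{j,a}g` (so `t(f,f) = ∫|∇f|²`). -/
def tform (m : ℕ) (L : ℝ) (f g : Config (m + 1) → ℂ) : ℂ :=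
  ∫ X in cellN (m + 1) L, ∑ j : Fin (m + 1), ∑ a : Fin 3,
    conj (fderiv ℝ f X (Pi.single j (EuclideanSpace.single a (1 : ℝ)))) *
      fderiv ℝ g X (Pi.single j (EuclideanSpace.single a (1 : ℝ)))

/-- The INTERACTION sesquilinear form `𝓥(f, g) = ∫_{cell^N} Σ_{i<j} v^per(xᵢ−xⱼ) conj(f) g` (real part of the
periodic interaction, finite for finite profiles; so `𝓥(f,f) = ∫ V|f|²`). -/
def vform (v : ℝ → ℝ≥0∞) (m : ℕ) (L : ℝ) (f g : Config (m + 1) → ℂ) : ℂ :=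
  ∫ X in cellN (m + 1) L, ((periodicInteraction v L X).toReal : ℂ) * (conj (f X) * g X)

/-- The INTERACTION DOUBLE-COMMUTATOR FORM of the plain pair at `ψ` (the `v`-part of
`½⟨ψ, ([B†,[H,B]] + [B,[H,B†]])ψ⟩/N` written with forms only):
`𝒟^V(ψ) = Re[𝓥(ζ₊,ζ₊) + 𝓥(ζ₋,ζ₋) − 𝓥(ζ₊∘ζ₋ ψ, ψ) − 𝓥(ζ₋∘ζ₊ ψ, ψ)]`, `ζ₊ = plainUp`, `ζ₋ = plainDown`
(the compositions carry the factor `N⁻¹` automatically). -/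
def plainInteractionDefect (v : ℝ → ℝ≥0∞) (m : ℕ) (L : ℝ) (n : Fin 3 → ℤ) (ψ : Config (m + 1) → ℂ) : ℝ :=
  (vform v m L (plainUp m L n ψ) (plainUp m L n ψ) + vform v m L (plainDown m L n ψ) (plainDown m L n ψ) -
      vform v m L (plainUp m L n (plainDown m L n ψ)) ψ -
        vform v m L (plainDown m L n (plainUp m L n ψ)) ψ).re

/-! ## §1 Interfaces -/

/-- ALGEBRA OF THE PLAIN PAIR (output of `stub_plainPairAlgebra`; finite continuous `v`): at every `(N, L)` some `R₀` such
that for every mode `n` and periodic trial state `Ψ`, with `ζ₊ := N^{-1/2}B_nΨ`, `ζ₋ := N^{-1/2}B_n†Ψ`: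
(A1) `ζ±` are directions; (A2) their masses are `≤ R₀` and their energy forms are
`≤ R₀(1+‖n‖²)(E(Ψ)+1)`; (A3) zero defect against the LNSS source `‖ζ₊‖² + ‖ζ₋‖² ≤ 2N|σ(ζ₊,Ψ) + σ(Ψ,ζ₋)|`
(`N σ(ζ₊,Ψ) = ⟨ζ₊, Λ_n†Ψ⟩ = N^{-1/2}E[(n̂_n+1)n̂₀^{1/2}] ≥ 0`, `Nσ(Ψ,ζ₋) = ⟨Λ_nΨ,ζ₋⟩ = N^{-1/2}E[n̂_n(n̂₀+1)^{1/2}] ≥ 0`,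
and `j/N ≤ (j/N)^{1/2}` sectorwise); (A4) `weightedOcc n Ψ ≤ 2‖ζ₋‖²` (indeed `= ‖ζ₋‖²`). -/
def PlainPairAlgebra : Prop :=
  ∀ v : ℝ → ℝ≥0∞, IsRepulsiveFiniteRange v → IsFiniteContinuous v →
    ∀ (m : ℕ) (L : ℝ), 0 < L → ∃ R₀ : ℝ, 0 < R₀ ∧
      ∀ (n : Fin 3 → ℤ) (Ψ : PeriodicTrialState (m + 1) L),
        IsDirection m L (plainUp m L n Ψ.ψ) ∧
        IsDirection m L (plainDown m L n Ψ.ψ) ∧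
        mass L (plainUp m L n Ψ.ψ) ≤
          ENNReal.ofReal R₀ ∧
        mass L (plainDown m L n Ψ.ψ) ≤
          ENNReal.ofReal R₀ ∧
        eform v L (plainUp m L n Ψ.ψ) ≤
          ENNReal.ofReal (R₀ * (1 + ‖(fun j => (n j : ℝ))‖ ^ 2)) * (periodicEnergy v Ψ + 1) ∧
        eform v L (plainDown m L n Ψ.ψ) ≤
          ENNReal.ofReal (R₀ * (1 + ‖(fun j => (n j : ℝ))‖ ^ 2)) * (periodicEnergy v Ψ + 1) ∧
        mass L (plainUp m L n Ψ.ψ) +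
            mass L (plainDown m L n Ψ.ψ) ≤
          2 * ENNReal.ofReal (((m + 1 : ℕ) : ℝ) *
            ‖srcPair m L n (plainUp m L n Ψ.ψ) Ψ.ψ +
              srcPair m L n Ψ.ψ (plainDown m L n Ψ.ψ)‖) ∧
        weightedOcc m L n Ψ.ψ ≤
          2 * mass L (plainDown m L n Ψ.ψ)

/-- THE EXACT KINETIC IDENTITY OF THE PLAIN PAIR (part of the output of `stub_plainPairAlgebra`; form-level
`[−Δ, B_n] = |k|²B_n`, since `P_iΔ_i = 0` and `[∇_j, P_i] = 0` on periodic functions): for periodic `C¹` `f, g`,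
`t(f, ζ₊ g) − t(ζ₋ f, g) = (2π/L)²|n|² ⟨f, ζ₊ g⟩` (`ζ₊ = plainUp`, `ζ₋ = plainDown`; the dead line's
`bareSecondVariation_kinetic_identity` without the `n̂₀^{-1/2}`). -/
def PlainKineticIdentity : Prop :=
  ∀ (m : ℕ) (L : ℝ), 0 < L → ∀ (n : Fin 3 → ℤ) (f g : Config (m + 1) → ℂ),
    ContDiff ℝ 1 f →
    (∀ (X : Config (m + 1)) (i : Fin (m + 1)) (k : Fin 3), f (X + Pi.single i (EuclideanSpace.single k L)) = f X) →
    ContDiff ℝ 1 g →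
    (∀ (X : Config (m + 1)) (i : Fin (m + 1)) (k : Fin 3), g (X + Pi.single i (EuclideanSpace.single k L)) = g X) →
      tform m L f (plainUp m L n g) - tform m L (plainDown m L n f) g =
        ((((2 * Real.pi / L) ^ 2 * ∑ a : Fin 3, ((n a : ℝ)) ^ 2 : ℝ)) : ℂ) *
          ∫ X in cellN (m + 1) L, conj (f X) * plainUp m L n g X

/-- THE INTERACTION DOUBLE COMMUTATOR OF THE PLAIN PAIR IS STATE-INDEPENDENT (output of `stub_plainInteraction`;
finite continuous `v`): a constant `C` (after `v`; `C ≍ ‖v‖₁`) with, for EVERY periodic trial state `Ψ` of finite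
energy and every mode `n`, `|𝒟^V(Ψ)| ≤ C (ρ + √(ρ·E(Ψ)/N))`, `ρ = N/L³`.  Mechanism: pair by pair — for the pair `(i,j)`
the slots `l ∉ {i,j}` drop out of `𝒟^{v_ij}` exactly (they commute with `v_ij` and with the `(i,j)`-slot operators and
are `L²`-adjoint), and the `(i,j)` terms are `≤ C‖v‖₁L⁻³(‖P_iΨ‖² + n_n/N)` (Jensen: `∫_cell v^per = ‖v‖₁`,
`slotAvg_pairPot`) or `≤ √(C‖v‖₁L⁻³ · ⟨Ψ, v_ij Ψ⟩)` with `⟨Ψ, v_ijΨ⟩ = 2E_V(Ψ)/(N(N−1))` (Cauchy–Schwarz with the weight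
`v ≥ 0`, Bose symmetry); `N(N−1)/2` pairs and the factor `N⁻¹` of the scaled pair give `C(ρ‖v‖₁ + √(ρ‖v‖₁E(Ψ)/N))`. -/
def PlainInteractionBound : Prop :=
  ∀ v : ℝ → ℝ≥0∞, IsRepulsiveFiniteRange v → IsFiniteContinuous v →
    ∃ C : ℝ, 0 < C ∧ ∀ (m : ℕ) (L : ℝ), 0 < L → ∀ (n : Fin 3 → ℤ) (Ψ : PeriodicTrialState (m + 1) L),
      periodicEnergy v Ψ ≠ ⊤ →
        |plainInteractionDefect v m L n Ψ.ψ| ≤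
          C * (((m + 1 : ℕ) : ℝ) / L ^ 3 +
            Real.sqrt ((((m + 1 : ℕ) : ℝ) / L ^ 3) * (periodicEnergy v Ψ).toReal / ((m + 1 : ℕ) : ℝ)))

/-- THE SECOND VARIATION OF THE PLAIN PAIR (output of `stub_plainPairCost`; the KLS double commutator of the one-body
operator `B_n`, finite continuous `v`): constants `c₁, c₂` (after `v`; `c₂ ≍ ‖v‖₁`) such that at every `(N, L)` with
`E₀ < ∞` there is a slack `δ > 0` with, for every `δ`-near-minimiser `Ψ` and every `n`,
`𝓔(ζ₊) + 𝓔(ζ₋) ≤ E₀(‖ζ₊‖² + ‖ζ₋‖²) + (c₁k² + c₂ρ)(1 + ‖ζ₊‖² + ‖ζ₋‖²)`, `ρ = N/L³`, `k = 2π‖n‖/L`.  Mechanism: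
parallelogram to the hermitian `A₁ = B+B†`, `A₂ = i(B†−B)`; for hermitian `A`, `q̃(AΨ) = 𝒟_A(Ψ) + Re q̃(A²Ψ, Ψ)` with
the double-commutator FORM `𝒟_A(Ψ) := 𝓔(AΨ,AΨ) − Re 𝓔(A²Ψ,Ψ)` and `|q̃(A²Ψ,Ψ)| ≤ √(q̃(A²Ψ)·δ)`; kinetic part from the
exact identity `t(f, B g) − t(B†f, g) = |k|²⟨f, B g⟩` (`P_i Δ_i = 0` on periodic functions, `[∇_j, P_i] = 0`), giving
`𝒟^kin_{A₁} + 𝒟^kin_{A₂} = 2|k|²(‖BΨ‖² − ‖B†Ψ‖²) ≤ 2|k|²‖BΨ‖²`; interaction part pair by pair: for the pair `(i,j)`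
the slots `l ∉ {i,j}` drop out of `𝒟^{v_ij}` exactly (they commute with `v_ij` and with the `(i,j)` slots and are
`L²`-symmetric), and the remaining `(i,j)` terms are `≤ C(‖v‖₁L⁻³‖P_iΨ‖² + √(‖v‖₁L⁻³·⟨Ψ, v_ijΨ⟩))` by Jensen for cell
averages and Cauchy–Schwarz; summed over pairs `≤ CNρ(‖v‖₁ + √(8πa‖v‖₁))`, and `4πa ≤ ‖v‖₁/2`. -/
def PlainPairCost : Prop :=
  ∀ v : ℝ → ℝ≥0∞, IsRepulsiveFiniteRange v → IsFiniteContinuous v →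
    ∃ c₁ c₂ : ℝ, 0 < c₁ ∧ 0 < c₂ ∧ ∀ (m : ℕ) (L : ℝ), 0 < L →
      periodicGroundStateEnergy v (m + 1) L ≠ ⊤ →
      ∃ δ : ℝ≥0∞, 0 < δ ∧ ∀ Ψ : PeriodicTrialState (m + 1) L,
        periodicEnergy v Ψ ≤ periodicGroundStateEnergy v (m + 1) L + δ →
        ∀ n : Fin 3 → ℤ,
          eform v L (plainUp m L n Ψ.ψ) +
              eform v L (plainDown m L n Ψ.ψ) ≤
            periodicGroundStateEnergy v (m + 1) L *
                (mass L (plainUp m L n Ψ.ψ) +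
                  mass L (plainDown m L n Ψ.ψ)) +
              ENNReal.ofReal
                ((c₁ * (2 * Real.pi * ‖(fun j => (n j : ℝ))‖ / L) ^ 2 + c₂ * (((m + 1 : ℕ) : ℝ) / L ^ 3)) *
                  (1 + (mass L (plainUp m L n Ψ.ψ) +
                    mass L (plainDown m L n Ψ.ψ)).toReal))

/-- WEIGHTED WITNESS FAMILY FOR ONE POTENTIAL (the interface fed to `stub_weightedWindowLaw`; = the dead line's
`DressedWitnessFamilyFor v` with (W4) stated for the WEIGHTED occupation): for every `M`, constants `ρ₁, c₁, c₂, γ, N₁`;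
for `N ≥ N₁`, `N ≤ ρ₁L³`, `E₀ < ∞` a radius `R` and a slack `δ`; for every `δ`-near-minimiser a defect budget `d` with
window sum `≤ γ√ρN`; per window mode directions `ζ±` of mass/form `≤ R` with (W2), (W3) and
(W4) `weightedOcc n Ψ ≤ 2‖ζ₋‖² + d(n)`. -/
def WeightedWitnessFamilyFor (v : ℝ → ℝ≥0∞) : Prop :=
  ∀ M : ℝ, 0 < M →
    ∃ ρ₁ c₁ c₂ γ : ℝ, 0 < ρ₁ ∧ 0 < c₁ ∧ 0 < c₂ ∧ 0 < γ ∧ ∃ N₁ : ℕ, ∀ m : ℕ, N₁ ≤ m + 1 →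
      ∀ L : ℝ, 0 < L → ((m + 1 : ℕ) : ℝ) ≤ ρ₁ * L ^ 3 →
        periodicGroundStateEnergy v (m + 1) L ≠ ⊤ →
        ∃ R : ℝ, 0 < R ∧ ∃ δ : ℝ≥0∞, 0 < δ ∧ ∀ Ψ : PeriodicTrialState (m + 1) L,
          periodicEnergy v Ψ ≤ periodicGroundStateEnergy v (m + 1) L + δ →
          ∃ d : (Fin 3 → ℤ) → ℝ≥0∞,
            windowSum M m L d ≤
                ENNReal.ofReal (γ * Real.sqrt (((m + 1 : ℕ) : ℝ) / L ^ 3) * (m + 1)) ∧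
            ∀ n : Fin 3 → ℤ, n ≠ 0 → InWindow M m L n →
              ∃ ζp ζm : Config (m + 1) → ℂ, IsDirection m L ζp ∧ IsDirection m L ζm ∧
                mass L ζp ≤ ENNReal.ofReal R ∧ mass L ζm ≤ ENNReal.ofReal R ∧
                eform v L ζp ≤ ENNReal.ofReal R ∧ eform v L ζm ≤ ENNReal.ofReal R ∧
                eform v L ζp + eform v L ζm ≤
                    periodicGroundStateEnergy v (m + 1) L * (mass L ζp + mass L ζm) +
                      ENNReal.ofReal
                        ((c₁ * (2 * Real.pi * ‖(fun j => (n j : ℝ))‖ / L) ^ 2 +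
                            c₂ * (((m + 1 : ℕ) : ℝ) / L ^ 3)) *
                          (1 + (mass L ζp + mass L ζm).toReal)) ∧
                mass L ζp + mass L ζm ≤
                    2 * ENNReal.ofReal (((m + 1 : ℕ) : ℝ) *
                      ‖srcPair m L n ζp Ψ.ψ + srcPair m L n Ψ.ψ ζm‖) + d n ∧
                weightedOcc m L n Ψ.ψ ≤ 2 * mass L ζm + d n

/-- WEIGHTED WINDOW BOUND FOR ONE POTENTIAL (output of `stub_weightedWindowLaw`): for every `M` there are `ρ₁, K, N₁`
such that for `N = m+1 ≥ N₁`, `L > 0`, `N ≤ ρ₁L³`, `E₀ < ∞`, some slack `δ > 0` makes every `δ`-near-minimiser satisfy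
`Σ_{0 < 2π‖p‖_∞/L ≤ M√ρ} N⁻¹‖a₀†a_pΨ‖² ≤ K √ρ N`. -/
def WeightedWindowBoundFor (v : ℝ → ℝ≥0∞) : Prop :=
  ∀ M : ℝ, 0 < M →
    ∃ ρ₁ K : ℝ, 0 < ρ₁ ∧ 0 < K ∧ ∃ N₁ : ℕ, ∀ m : ℕ, N₁ ≤ m + 1 →
      ∀ L : ℝ, 0 < L → ((m + 1 : ℕ) : ℝ) ≤ ρ₁ * L ^ 3 →
        periodicGroundStateEnergy v (m + 1) L ≠ ⊤ →
        ∃ δ : ℝ≥0∞, 0 < δ ∧ ∀ Ψ : PeriodicTrialState (m + 1) L,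
          periodicEnergy v Ψ ≤ periodicGroundStateEnergy v (m + 1) L + δ →
            windowSum M m L (fun p => weightedOcc m L p Ψ.ψ) ≤
              ENNReal.ofReal (K * Real.sqrt (((m + 1 : ℕ) : ℝ) / L ^ 3) * (m + 1))

/-! ## §2 Registered stub signatures (skeleton v3) -/

/-- Registered signature of `stub_plainPairAlgebra` [L; LnssAlgebra / BareAdmissible / BareSecondVariation-kinetic toolkit of
the dead line: `budget_sum_fourierAvg_le`, `budget_phase_le`, `budget_cellAvg_le`, `natMul_srcPair_eq_inner_lnssUpper/Lower`,
sector decomposition through `modeProj`; slot derivative rules `fourierAvg_fderiv_single_self`, `fderiv_cellAvg_single`,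
`integral_conj_fderiv_mul_slotUpper` for the kinetic identity]. -/
def Sig.stub_plainPairAlgebra : Prop :=
  LNSSAlgebra → PlainPairAlgebra ∧ PlainKineticIdentity

/-- Registered signature of `stub_plainInteraction` [L; the anomaly-free interaction double commutator, mechanism in the
docstring of `PlainInteractionBound`]. -/
def Sig.stub_plainInteraction : Prop :=
  PlainInteractionBound

/-- Registered signature of `stub_plainPairCost` [L; the near-minimiser assembly: parallelogram to `A₁ = B+B†`,
`A₂ = i(B†−B)`; for hermitian `A`, `q̃(AΨ) = 𝒟_A(Ψ) + Re q̃(A²Ψ, Ψ)` with `𝒟_A := 𝓔(AΨ,AΨ) − Re 𝓔(A²Ψ,Ψ)` and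
`|q̃(A²Ψ,Ψ)| ≤ √(q̃(A²Ψ)·δ)` (`eform_line_add_line`, `e0_mul_mass_le_eform`), `𝒟_{A₁} + 𝒟_{A₂} = 2𝒟_B`,
`𝒟_B^kin = |k|²(‖ζ₊‖² − ‖ζ₋‖²)` from `PlainKineticIdentity` used twice, `|𝒟_B^V| = |𝒟^V|` from
`PlainInteractionBound`, a-priori budgets of `A_j²Ψ` (`budget_*`), and `E₀/N ≤ ρ‖v‖₁/2` (constant trial state) to turn
`√(ρE/N)` into `ρ`; `δ` chosen after `(N, L)`]. -/
def Sig.stub_plainPairCost : Prop :=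
  PlainKineticIdentity → PlainInteractionBound → PlainPairCost

/-- Registered signature of `stub_weightedWindowLaw` [M; clone of the landed `stub_windowLaw`: its `occ_le_of_mode` /
`windowSum_le_of_pointwise` are generic in the occupation functional]. -/
def Sig.stub_weightedWindowLaw : Prop :=
  TwoSidedDualNorm → ∀ v : ℝ → ℝ≥0∞, IsRepulsiveFiniteRange v →
    WeightedWitnessFamilyFor v → WeightedWindowBoundFor v

/-- Registered signature of `stub_bandFromWindow` [M/L; counting: `weightedOcc p ≤ n_p` (Cauchy–Schwarz) and the kinetic
tail off the window (`tsum_fracDispersion_two_mul_cellOccupation`, Dyson's bound), the second-moment count identity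
`Σ_{p≠0} weightedOcc p = Σ_S (|S|+1)(N−|S|) w_S / N` (one-slot Parseval, unary and polarised, + `Σ_S|S|(|S|−1)w_S =
Σ_{i≠j}‖P_iP_jΨ‖²`), Markov on the band `(|S|+1)(N−|S|)/N ≥ θβN`; `stub_countLaw` is landed and importable]. -/
def Sig.stub_bandFromWindow : Prop :=
  ∀ v : ℝ → ℝ≥0∞, IsRepulsiveFiniteRange v → WeightedWindowBoundFor v → BandEmptiness v

/-! ## §3 Glue (sorry-free) -/

/-- **The plain pair is a weighted witness family for integrable `v`** (glue; constants `ρ₁ = γ = 1`, `N₁ = 0`,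
`R = R₀(1 + J²)(E₀ + 2)` with `J = M√ρ L/2π`, `δ = min δ_cost 1`, zero defect) — verbatim the dead line's `dwf_of_bare`
with the plain pair. -/
theorem weightedFamily_of_plain (hA : PlainPairAlgebra) (hS : PlainPairCost) :
    ∀ v : ℝ → ℝ≥0∞, IsRepulsiveFiniteRange v → IsFiniteContinuous v →
      WeightedWitnessFamilyFor v := by
  intro v hv hfc M hM
  obtain ⟨c₁, c₂, hc₁, hc₂, hSV⟩ := hS v hv hfc
  refine ⟨1, c₁, c₂, 1, one_pos, hc₁, hc₂, one_pos, 0, ?_⟩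
  intro m _ L hL _ hE0
  obtain ⟨R₀, hR₀, hAd⟩ := hA v hv hfc m L hL
  obtain ⟨δ, hδ, hSVΨ⟩ := hSV m L hL hE0
  set Jr : ℝ := M * Real.sqrt (((m + 1 : ℕ) : ℝ) / L ^ 3) * L / (2 * Real.pi) with hJr
  set E0r : ℝ := (periodicGroundStateEnergy v (m + 1) L).toReal with hE0r
  have hE0r0 : 0 ≤ E0r := ENNReal.toReal_nonneg
  have hE0eq : periodicGroundStateEnergy v (m + 1) L = ENNReal.ofReal E0r :=
    (ENNReal.ofReal_toReal hE0).symm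
  set R : ℝ := R₀ * (1 + Jr ^ 2) * (E0r + 2) with hR
  have hRpos : 0 < R := by positivity
  have hR₀R : R₀ ≤ R := by
    have h1 : (1 : ℝ) ≤ (1 + Jr ^ 2) * (E0r + 2) := by nlinarith [sq_nonneg Jr, hE0r0]
    calc R₀ = R₀ * 1 := (mul_one _).symm
      _ ≤ R₀ * ((1 + Jr ^ 2) * (E0r + 2)) := by gcongr
      _ = R := by rw [hR]; ring
  refine ⟨R, hRpos, min δ 1, lt_min hδ one_pos, ?_⟩
  intro Ψ hΨ
  have hΨδ : periodicEnergy v Ψ ≤ periodicGroundStateEnergy v (m + 1) L + δ :=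
    hΨ.trans (add_le_add le_rfl (min_le_left _ _))
  have hΨ1 : periodicEnergy v Ψ + 1 ≤ ENNReal.ofReal (E0r + 2) := by
    calc periodicEnergy v Ψ + 1 ≤ periodicGroundStateEnergy v (m + 1) L + min δ 1 + 1 := by gcongr
      _ ≤ ENNReal.ofReal E0r + 1 + 1 := by rw [hE0eq]; gcongr; exact min_le_right _ _
      _ = ENNReal.ofReal (E0r + 2) := by
          rw [add_assoc, ← one_add_one_eq_two, ENNReal.ofReal_add hE0r0 (by norm_num)]
          norm_num
  refine ⟨fun _ => 0, ?_, ?_⟩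
  · rw [windowSum_zero]; exact bot_le
  · intro n _ hwin
    obtain ⟨hdirp, hdirm, h1, h2, h3, h4, h5, h6⟩ := hAd n Ψ
    have hnJ : ‖(fun j => (n j : ℝ))‖ ≤ Jr := by
      have hw : 2 * Real.pi * ‖(fun j => (n j : ℝ))‖ / L ≤
          M * Real.sqrt (((m + 1 : ℕ) : ℝ) / L ^ 3) := hwin
      rw [div_le_iff₀ hL] at hw
      rw [hJr, le_div_iff₀ (by positivity)]
      linarith
    have heform : ∀ {e : ℝ≥0∞},
        e ≤ ENNReal.ofReal (R₀ * (1 + ‖(fun j => (n j : ℝ))‖ ^ 2)) * (periodicEnergy v Ψ + 1) →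
          e ≤ ENNReal.ofReal R := by
      intro e he
      calc e ≤ ENNReal.ofReal (R₀ * (1 + ‖(fun j => (n j : ℝ))‖ ^ 2)) * (periodicEnergy v Ψ + 1) := he
        _ ≤ ENNReal.ofReal (R₀ * (1 + Jr ^ 2)) * ENNReal.ofReal (E0r + 2) := by
            have h0 : 0 ≤ ‖(fun j => (n j : ℝ))‖ := norm_nonneg _
            gcongr
        _ = ENNReal.ofReal R := by
            rw [← ENNReal.ofReal_mul (by positivity), hR]
    refine ⟨_, _, hdirp, hdirm, h1.trans (ENNReal.ofReal_le_ofReal hR₀R),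
      h2.trans (ENNReal.ofReal_le_ofReal hR₀R), heform h3, heform h4, hSVΨ Ψ hΨδ n, ?_, ?_⟩
    · simpa only [add_zero] using h5
    · simpa only [add_zero] using h6

/-- A finite continuous profile of finite range is integrable on `ℝ³` (bounded and compactly supported). -/
theorem lintegral_ne_top_of_isFiniteContinuous {v : ℝ → ℝ≥0∞} (hv : IsRepulsiveFiniteRange v)
    (hfc : IsFiniteContinuous v) : (∫⁻ x : Space, v ‖x‖) ≠ ⊤ := by
  obtain ⟨hmeas, R₀, hR₀⟩ := hv
  obtain ⟨M, hM⟩ := Theorems.exists_bound_of_continuous_finiteRange hfc.1 hfc.2 hR₀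
  set R : ℝ := max R₀ 0 with hR
  have hsupp : ∀ x : Space, x ∉ Metric.closedBall (0 : Space) R → v ‖x‖ = 0 := fun x hx => by
    rw [Metric.mem_closedBall, dist_zero_right, not_le] at hx
    exact hR₀ _ ((le_max_left _ _).trans_lt hx)
  have hle : ∀ x : Space, v ‖x‖ ≤ (Metric.closedBall (0 : Space) R).indicator (fun _ => (M : ℝ≥0∞)) x := by
    intro x
    by_cases hx : x ∈ Metric.closedBall (0 : Space) R
    · rw [Set.indicator_of_mem hx]; exact hM x
    · rw [hsupp x hx]; exact bot_le
  refine ne_top_of_le_ne_top ?_ (lintegral_mono hle)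
  rw [lintegral_indicator Metric.isClosed_closedBall.measurableSet, setLIntegral_const]
  exact ENNReal.mul_ne_top ENNReal.coe_ne_top (measure_closedBall_lt_top (x := (0 : Space))).ne

/-- **The reshaped chain concludes `stub_projectedDichotomy` BY NAME**: GD ⟶ (landed `stub_chordVariation`) two-sided
dual norm ⟶ (plain pair algebra + cost, with the landed `stub_lnssAlgebra`) weighted witness family ⟶ (weighted window
law) weighted window bound ⟶ (counting) band emptiness, for every admissible finite continuous profile. -/
theorem projectedDichotomy_of :
    Sig.stub_plainPairAlgebra → Sig.stub_plainInteraction → Sig.stub_plainPairCost → Sig.stub_weightedWindowLaw →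
      Sig.stub_bandFromWindow → Sig.stub_projectedDichotomy := by
  intro hA hI hS hW hB hG v hv hfc
  exact hB v hv (hW (stub_chordVariation hG) v hv
    (weightedFamily_of_plain (hA stub_lnssAlgebra).1 (hS (hA stub_lnssAlgebra).2 hI) v hv hfc))

end Summit.AtomisticToContinuum.BoseEinsteinCondensation.Cruxes.GDTransfer.Seeded

end
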